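import Summits.Ventures.LatticeQCDFlow.Exactness.Phi4MetropolisSiteMeanEnergyChange
import Summits.Ventures.LatticeQCDFlow.Exactness.Phi4MetropolisSitePinskerFloor
import Literature.Probability.Distributions.GaussianMoments
import HarnessLib

/-!
# The local arm with GAUSSIAN steps `u ∼ N(0, v)`: `m₄ = 3v²`, `⟨ΔS_x⟩ = v(J_xx + 6λ⟨φ_x²⟩) + 3λv²`,
# the two site acceptance floors unconditionally, and the window comparison at equal variance

HONEST FRAMING: exact (Metropolis-corrected) sampling algorithms for lattice gauge theory;
figures of merit are autocorrelation/cost numbers at stated couplings and volumes; no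
continuum-physics claim.  (SCALAR calibration rung S0-A: not a gauge result.)

Venture `LatticeQCDFlow` (cell pub-lqcd), topic `Exactness`; FANOUT row 2 (`s0-phi4`, LOCAL arm: the
single-site Metropolis update with a symmetric step law `ρ`).  NEW WORK of the cell — the Gaussian
instance of GEN-24's `Phi4MetropolisSiteMeanEnergyChange` (`⟨ΔS_x⟩ = m₂(J_xx + 6λ⟨φ_x²⟩) + λm₄` for
every even step law with moments; the WINDOW instance `m₂ = δ²/3`, `m₄ = δ⁴/5` is there) composed with
`Phi4MetropolisSiteInvolution` / `Phi4MetropolisSitePinskerFloor` (the site update is a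
volume-preserving involution ⇒ Bretagnolle–Huber and Pinsker acceptance floors from `⟨ΔS_x⟩`).  The
Gaussian step law's evenness, moments of all orders and `m₂ = v` are the tree's
(`Phi4MetropolisMagnetisationMomentCSD`: `gaussianPDFReal_zero_neg`, `gaussianPDFReal_moments`,
`integral_sq_mul_gaussianPDFReal`); the one new ingredient is the fourth moment, read off the tree's
Literature file `Probability/Distributions/GaussianMoments` (`∫ x^{2r} dN(0,v) = v^r (2r−1)‼`,
Janson 1997 Rem. 1.30).  Nothing is cited as a fact here; no definition is introduced.

## What is proved (`v : ℝ≥0`, `v ≠ 0` the proposal variance; every `λ > 0`, real `J`, site `x`)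

* `integral_pow_four_mul_gaussianPDFReal` — `∫ u⁴ N(0,v)(u) du = 3v²`;
* **`meanDeltaS_site_gaussian`** — `⟨ΔS_x⟩ = v·(J_xx + 6λ⟨φ_x²⟩) + 3λv²` (the mean proposed energy
  change of the Gaussian site update, in closed form up to the one Gibbs moment `⟨φ_x²⟩`);
* **`meanDeltaS_site_window_eq_gaussian_sub`** — AT EQUAL STEP VARIANCE (`δ² = 3v`) the uniform
  window proposes a smaller mean energy change than the Gaussian, by exactly `(6/5)λv²`
  (`m₄ = 9v²/5` against `3v²`; the quadratic parts agree);
* **`phi4MetropolisSite_acceptance_ge_gaussian`** — `∫∫ min(1, e^{−ΔS_x}) N(0,v) e^{−S} ≥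
  (1 − √(1 − e^{−Θ_x(v)}))·Z`, and **`phi4MetropolisSite_acceptance_ge_pinsker_gaussian`** —
  `≥ (1 − √(Θ_x(v)/2))·Z`, with `Θ_x(v) = v(J_xx + 6λ⟨φ_x²⟩) + 3λv²`, UNCONDITIONAL (all
  hypotheses of the involution files discharged for the Gaussian law, which is positive everywhere).

Reading for S0-A (no numerics implied): the Gaussian-step local arm's per-site rejection rate is at
most `√(Θ_x(v)/2) = √(v(J_xx + 6λ⟨φ_x²⟩)/2 + 3λv²/2)` — it vanishes like `√v` at small steps with a
coefficient fixed by ONE measured Gibbs moment; at matched proposal variance the window's floor is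
the higher one.  NOT CLAIMED: any value of `⟨φ_x²⟩` or of an acceptance for any run; optimality of any
`v`; anything about autocorrelations (the step-law comparison of `τ_int` is
`Phi4MetropolisStepLawComparison` / `Phi4MetropolisGaussianMonotone`).
-/

namespace Summit.Ventures.LatticeQCDFlow.Exactness

open Real MeasureTheory ProbabilityTheory Filter Finset Set
open Summit.Ventures.LatticeQCDFlow.Scoring
open scoped NNReal

variable {n : ℕ}

/-! ## §1 The fourth moment of the Gaussian step law -/

/-- **`m₄ = 3v²` for Gaussian steps**: `∫ u⁴ N(0,v)(u) du = 3v²` (`v ≠ 0`; the tree's Literature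
`integral_pow_even_gaussianReal` with `r = 2`, `3‼ = 3`, moved onto the density). -/
theorem integral_pow_four_mul_gaussianPDFReal {v : ℝ≥0} (hv : v ≠ 0) :
    ∫ u : ℝ, u ^ 4 * gaussianPDFReal 0 v u = 3 * (v : ℝ) ^ 2 := by
  have h := Literature.Probability.Distributions.integral_pow_even_gaussianReal v 2
  rw [integral_gaussianReal_eq_integral_smul hv] at h
  have e : (fun u : ℝ => u ^ 4 * gaussianPDFReal 0 v u)
      = fun u => gaussianPDFReal 0 v u • u ^ (2 * 2) := by
    funext u; rw [smul_eq_mul, mul_comm]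
  rw [e, h]
  have h3 : ((Nat.doubleFactorial (2 * 2 - 1) : ℕ) : ℝ) = 3 := by norm_num [Nat.doubleFactorial]
  rw [h3, mul_comm]

/-! ## §2 The mean proposed energy change of the Gaussian site update -/

/-- **`⟨ΔS_x⟩ = v·(J_xx + 6λ⟨φ_x²⟩) + 3λv²` FOR GAUSSIAN STEPS `u ∼ N(0, v)`** (`v ≠ 0`; every
`λ > 0`, real `J`, site `x`). -/
theorem meanDeltaS_site_gaussian {lam : ℝ} (hlam : 0 < lam) (J : Fin (n + 1) → Fin (n + 1) → ℝ)
    {v : ℝ≥0} (hv : v ≠ 0) (x : Fin (n + 1)) :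
    (∫ p, (latticePhi4Action J lam (p.2 + Pi.single x p.1) - latticePhi4Action J lam p.2)
        * (gibbsWeight J lam p.2 * gaussianPDFReal 0 v p.1)
          ∂((volume : Measure ℝ).prod (volume : Measure (Fin (n + 1) → ℝ))))
        / gibbsZ J lam
      = (v : ℝ) * (J x x + 6 * lam * gibbsExpect J lam (fun φ => φ x ^ 2))
        + 3 * lam * (v : ℝ) ^ 2 := by
  rw [meanDeltaS_site_eq hlam J (fun u => gaussianPDFReal_nonneg 0 v u) (measurable_gaussianPDFReal 0 v)
    (gaussianPDFReal_zero_neg v) (gaussianPDFReal_moments hv) x, integral_sq_mul_gaussianPDFReal hv,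
    integral_pow_four_mul_gaussianPDFReal hv]
  ring

/-- **WINDOW VERSUS GAUSSIAN AT EQUAL STEP VARIANCE**: with `δ² = 3v` (so both proposals have
second moment `v`) the window's mean energy change is SMALLER by `(6/5)λv²`
(`m₄ = 9v²/5` against `3v²`):  `⟨ΔS_x⟩_window = ⟨ΔS_x⟩_Gauss − (6/5)λv²`. -/
theorem meanDeltaS_site_window_eq_gaussian_sub {lam : ℝ} (hlam : 0 < lam)
    (J : Fin (n + 1) → Fin (n + 1) → ℝ) {v : ℝ≥0} (hv : v ≠ 0) {δ : ℝ} (hδ : 0 < δ)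
    (hδv : δ ^ 2 = 3 * (v : ℝ)) (x : Fin (n + 1)) :
    (∫ p, (latticePhi4Action J lam (p.2 + Pi.single x p.1) - latticePhi4Action J lam p.2)
        * (gibbsWeight J lam p.2 * (Icc (-δ) δ).indicator (fun _ : ℝ => (2 * δ)⁻¹) p.1)
          ∂((volume : Measure ℝ).prod (volume : Measure (Fin (n + 1) → ℝ))))
        / gibbsZ J lam
      = (∫ p, (latticePhi4Action J lam (p.2 + Pi.single x p.1) - latticePhi4Action J lam p.2)
          * (gibbsWeight J lam p.2 * gaussianPDFReal 0 v p.1)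
            ∂((volume : Measure ℝ).prod (volume : Measure (Fin (n + 1) → ℝ))))
          / gibbsZ J lam
        - 6 / 5 * lam * (v : ℝ) ^ 2 := by
  rw [meanDeltaS_site_window hlam J hδ x, meanDeltaS_site_gaussian hlam J hv x]
  have h4 : δ ^ 4 = 9 * (v : ℝ) ^ 2 := by
    rw [show δ ^ 4 = (δ ^ 2) ^ 2 by ring, hδv]; ring
  rw [h4, hδv]
  ring

/-! ## §3 The site acceptance floors for Gaussian steps, unconditional -/

/-- **GAUSSIAN-STEP ACCEPTANCE FLOOR (Bretagnolle–Huber form)**: for the single-site Metropolis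
update of lattice φ⁴ with steps `u ∼ N(0, v)` (`v ≠ 0`; every `λ > 0`, real `J`, site `x`):
`∫∫ min(1, e^{−ΔS_x}) N(0,v)(u) e^{−S(φ)} ≥ (1 − √(1 − exp(−Θ_x(v))))·Z`,
`Θ_x(v) = v(J_xx + 6λ⟨φ_x²⟩) + 3λv²`. -/
theorem phi4MetropolisSite_acceptance_ge_gaussian {lam : ℝ} (hlam : 0 < lam)
    (J : Fin (n + 1) → Fin (n + 1) → ℝ) {v : ℝ≥0} (hv : v ≠ 0) (x : Fin (n + 1)) :
    (1 - Real.sqrt (1 - Real.exp (-((v : ℝ) * (J x x + 6 * lam * gibbsExpect J lam (fun φ => φ x ^ 2))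
        + 3 * lam * (v : ℝ) ^ 2)))) * gibbsZ J lam
      ≤ ∫ p, min 1 (Real.exp (-(latticePhi4Action J lam (p.2 + Pi.single x p.1)
          - latticePhi4Action J lam p.2))) * (gibbsWeight J lam p.2 * gaussianPDFReal 0 v p.1)
          ∂((volume : Measure ℝ).prod (volume : Measure (Fin (n + 1) → ℝ))) := by
  have hΔ := integrable_deltaS_site hlam J (fun u => gaussianPDFReal_nonneg 0 v u)
    (measurable_gaussianPDFReal 0 v) (gaussianPDFReal_moments hv) x
  have h := phi4MetropolisSite_acceptance_ge hlam J (fun u => gaussianPDFReal_pos 0 v u hv)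
    (measurable_gaussianPDFReal 0 v) (gaussianPDFReal_zero_neg v) (integral_gaussianPDFReal_eq_one 0 hv)
    x hΔ
  rw [meanDeltaS_site_gaussian hlam J hv x] at h
  exact h

/-- **GAUSSIAN-STEP ACCEPTANCE FLOOR (Pinsker form)**: same setting,
`∫∫ min(1, e^{−ΔS_x}) N(0,v)(u) e^{−S(φ)} ≥ (1 − √(Θ_x(v)/2))·Z`. -/
theorem phi4MetropolisSite_acceptance_ge_pinsker_gaussian {lam : ℝ} (hlam : 0 < lam)
    (J : Fin (n + 1) → Fin (n + 1) → ℝ) {v : ℝ≥0} (hv : v ≠ 0) (x : Fin (n + 1)) :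
    (1 - Real.sqrt ((((v : ℝ) * (J x x + 6 * lam * gibbsExpect J lam (fun φ => φ x ^ 2))
        + 3 * lam * (v : ℝ) ^ 2)) / 2)) * gibbsZ J lam
      ≤ ∫ p, min 1 (Real.exp (-(latticePhi4Action J lam (p.2 + Pi.single x p.1)
          - latticePhi4Action J lam p.2))) * (gibbsWeight J lam p.2 * gaussianPDFReal 0 v p.1)
          ∂((volume : Measure ℝ).prod (volume : Measure (Fin (n + 1) → ℝ))) := by
  have hΔ := integrable_deltaS_site hlam J (fun u => gaussianPDFReal_nonneg 0 v u)
    (measurable_gaussianPDFReal 0 v) (gaussianPDFReal_moments hv) x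
  have h := phi4MetropolisSite_acceptance_ge_pinsker hlam J (fun u => gaussianPDFReal_pos 0 v u hv)
    (measurable_gaussianPDFReal 0 v) (gaussianPDFReal_zero_neg v) (integral_gaussianPDFReal_eq_one 0 hv)
    x hΔ
  rw [meanDeltaS_site_gaussian hlam J hv x] at h
  exact h

end Summit.Ventures.LatticeQCDFlow.Exactness
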